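import Mathlib
import HarnessLib
import Summits.HubbardSuperconductivity.HubbardSuperconductivity.Theorems.KLProgrammeKLRegimeSplitEdgeFactsPinnedFloorCompl
import Summits.HubbardSuperconductivity.HubbardSuperconductivity.Theorems.KLProgrammeKLRegimeSplitEdgeFactsMatsubaraWindowCount
import Summits.HubbardSuperconductivity.HubbardSuperconductivity.Theorems.KLProgrammeKLRegimeSplitEdgeFactsCrossingColumns
import Summits.HubbardSuperconductivity.HubbardSuperconductivity.Theorems.KLProgrammeKLRegimeSplitEdgeFactsColumnAngleCount

/-!
# Route `KLProgramme` — edge facts for the pair masses ACROSS TRANSFERS, XVIII: the (D3′) PER-STEP PINNED FLOOR from EXPLICIT WINDOWS — one call composing the layer count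
# (`…PinnedFloorCompl`), the Matsubara window (`…MatsubaraWindowCount`), the crossing columns (`…LevelSetFloorColumns`/`…CrossingColumns`) and the column count
# (`…ColumnAngleCount`): `W_0(n) ≥ (64/243)·2k·Y·X/(βL²Λ_n²)` with `Y = (w−u)L/(2π) − 1` columns and `X = (B−A)L/(2π(4 + coeffNorm 1 K)) − 1` points per column

Cell gate-hubbard-kl, seat hubbard-kl-k3c1-p1 (g21; child-1 lineage).  Inputs, all numeric and read off the μ-window by E1: a Matsubara index `k ≤ M` with `(2k − 1)π/β ≤ W`,
`W² ≤ Λ_n²/8`; an energy window `A ≤ B ≤ 0` inside the shell (`Λ_n²/2 ≤ B²`, `A² ≤ 5Λ_n²/8`, e.g. `A = −0.79Λ_n`, `B = −0.71Λ_n`) with `X ≥ 0` (`L` large); an angular window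
`0 ≤ u ≤ w ≤ π` on which the column criterion holds (`(−2 − μ + coeffNorm 0 K − A)/2 ≤ cos w`, `cos u ≤ (2cos(π/L) − μ − coeffNorm 0 K − B)/2`).  Then

* §1 inclusions: `{ω² ≤ W²} ⊆ {ω² ≤ Λ_n²/8}`, `{A ≤ e_K ≤ B} ⊆ {Λ_n²/2 ≤ e_K² ≤ 5Λ_n²/8}`, cosine window ⊆ criterion set;
* §2 **`klpw_layer_card_ge`**: `2k·(Y·X) ≤ #layer`;
* §3 **`klpw_pinned_mass_floor_of_windows`**: `(64/243)·(2k·Y·X)/(βL²Λ_n²) ≤ −Σ_p t_n[s_{n,m}](0,p)` (`0 < β`, `n + 1 ≤ m`) — the per-step floor `b_lo` of (D3′) in closed form;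
  in size `2k ≍ βΛ_n`, `Y ≍ L`, `X ≍ Λ_n L` ⇒ `b_lo ≍ (w − u)(B − A)/Λ_n·… ≍ const`, uniform in `n, m` (the Cooper logarithm's per-scale constant).
Everything is proved; no definitions; nothing asserts any slot, stub, K3 or SC. [folklore]
-/

noncomputable section

namespace Summit.HubbardSuperconductivity.HubbardSuperconductivity.Theorems.KLRegimeSplit

set_option linter.dupNamespace false -- summit = problem name (single-conjunct summit), D-0017

open Real Finset Literature.MathematicalPhysics.QuantumLattice Literature.Probability.LatticeModels
open Summit.HubbardSuperconductivity.HubbardSuperconductivity.Theorems.KLProgrammeLegKernels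

section Window

variable {L M : ℕ} [NeZero L] (β μ : ℝ) (K : TrigPolyC4v)

/-! ## §1 Inclusions -/

omit [NeZero L] in
/-- A smaller frequency window is inside the layer's: `W² ≤ Λ²/8` ⟹ `#{ω² ≤ W²} ≤ #{ω² ≤ Λ²/8}`. [folklore] -/
theorem klpw_card_freq_mono {W Λ : ℝ} (hW : W ^ 2 ≤ Λ ^ 2 / 8) :
    ((univ : Finset (MatsubaraIdx M)).filter fun ν => matsubaraFreq β M ν ^ 2 ≤ W ^ 2).card ≤
      ((univ : Finset (MatsubaraIdx M)).filter fun ν => matsubaraFreq β M ν ^ 2 ≤ Λ ^ 2 / 8).card := by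
  classical
  refine Finset.card_le_card fun ν hν => ?_
  rw [mem_filter] at hν ⊢
  exact ⟨hν.1, hν.2.trans hW⟩

/-- A signed energy window inside the shell: `A ≤ B ≤ 0`, `Λ²/2 ≤ B²`, `A² ≤ 5Λ²/8` ⟹ `#{A ≤ e_K ≤ B} ≤ #{Λ²/2 ≤ e_K² ≤ 5Λ²/8}`. [folklore] -/
theorem klpw_card_shell_mono {A B Λ : ℝ} (hB : B ≤ 0) (hB2 : Λ ^ 2 / 2 ≤ B ^ 2) (hA2 : A ^ 2 ≤ 5 * Λ ^ 2 / 8) :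
    ((univ : Finset (TorusSite 2 L)).filter fun p => A ≤ nambuXiCT L μ K p ∧ nambuXiCT L μ K p ≤ B).card ≤
      ((univ : Finset (TorusSite 2 L)).filter fun p => Λ ^ 2 / 2 ≤ nambuXiCT L μ K p ^ 2 ∧ nambuXiCT L μ K p ^ 2 ≤ 5 * Λ ^ 2 / 8).card := by
  classical
  refine Finset.card_le_card fun p hp => ?_
  rw [mem_filter] at hp ⊢
  obtain ⟨-, h1, h2⟩ := hp
  refine ⟨mem_univ _, ?_, ?_⟩
  · nlinarith
  · nlinarith

/-- The cosine window sits inside the criterion set: `(−2 − μ + κ₀ − A)/2 ≤ cos w`, `cos u ≤ (2cos(π/L) − μ − κ₀ − B)/2` (`κ₀ = coeffNorm 0 K`) ⟹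
`#{cos w < cos(2πa/L) < cos u} ≤ #criterion`. [folklore] -/
theorem klpw_card_criterion_ge {A B u w : ℝ} (hwin_lo : (-2 - μ + K.coeffNorm 0 - A) / 2 ≤ Real.cos w)
    (hwin_hi : Real.cos u ≤ (2 * Real.cos (π / L) - μ - K.coeffNorm 0 - B) / 2) :
    ((univ : Finset (ZMod L)).filter fun a => Real.cos w < Real.cos (2 * π * (a.val : ℝ) / L) ∧ Real.cos (2 * π * (a.val : ℝ) / L) < Real.cos u).card ≤
      ((univ : Finset (ZMod L)).filter fun a =>
        -2 * Real.cos (2 * π * (a.val : ℝ) / L) - 2 - μ + K.coeffNorm 0 < A ∧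
          B < -2 * Real.cos (2 * π * (a.val : ℝ) / L) + 2 * Real.cos (π / L) - μ - K.coeffNorm 0).card := by
  classical
  refine Finset.card_le_card fun a ha => ?_
  rw [mem_filter] at ha ⊢
  obtain ⟨-, h1, h2⟩ := ha
  exact ⟨mem_univ _, by linarith, by linarith⟩

/-! ## §2 The layer count from the windows -/

/-- **Layer count from explicit windows**: with `Y = (w − u)L/(2π) − 1`, `X = (B − A)L/(2π(4 + coeffNorm 1 K)) − 1 ≥ 0` and the hypotheses of the module docstring,
`2k·(Y·X) ≤ #{k : Λ_n²/2 ≤ ω_k² + e_K² ≤ 3Λ_n²/4}`. [folklore] -/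
theorem klpw_layer_card_ge (hβ : 0 < β) (n : ℕ) {k : ℕ} (hk : k ≤ M) {W : ℝ} (hkW : (2 * (k : ℝ) - 1) * π / β ≤ W)
    (hW2 : W ^ 2 ≤ klScale klE0 n ^ 2 / 8) {A B : ℝ} (hAB : A ≤ B) (hB : B ≤ 0) (hB2 : klScale klE0 n ^ 2 / 2 ≤ B ^ 2)
    (hA2 : A ^ 2 ≤ 5 * klScale klE0 n ^ 2 / 8) (hX : 0 ≤ (B - A) * L / (2 * π * (4 + K.coeffNorm 1)) - 1) {u w : ℝ} (hu : 0 ≤ u) (huw : u ≤ w) (hw : w ≤ π)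
    (hwin_lo : (-2 - μ + K.coeffNorm 0 - A) / 2 ≤ Real.cos w) (hwin_hi : Real.cos u ≤ (2 * Real.cos (π / L) - μ - K.coeffNorm 0 - B) / 2) :
    2 * (k : ℝ) * ((((w - u) * L / (2 * π) - 1)) * ((B - A) * L / (2 * π * (4 + K.coeffNorm 1)) - 1)) ≤
      (((univ : Finset (FreqMomentum L M)).filter fun q =>
        klScale klE0 n ^ 2 / 2 ≤ matsubaraFreq β M q.1 ^ 2 + nambuXiCT L μ K q.2 ^ 2 ∧
          matsubaraFreq β M q.1 ^ 2 + nambuXiCT L μ K q.2 ^ 2 ≤ 3 * klScale klE0 n ^ 2 / 4).card : ℝ) := by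
  classical
  set Λ := klScale klE0 n with hΛ
  set X := (B - A) * L / (2 * π * (4 + K.coeffNorm 1)) - 1 with hXdef
  set Y := (w - u) * L / (2 * π) - 1 with hYdef
  -- frequency half
  have hfreq : (2 * k : ℕ) ≤ ((univ : Finset (MatsubaraIdx M)).filter fun ν => matsubaraFreq β M ν ^ 2 ≤ Λ ^ 2 / 8).card :=
    (klmw_two_mul_le_card_filter_matsubaraFreq_sq_le hβ hk hkW).trans (klpw_card_freq_mono β hW2)
  have hfreqR : 2 * (k : ℝ) ≤ (((univ : Finset (MatsubaraIdx M)).filter fun ν => matsubaraFreq β M ν ^ 2 ≤ Λ ^ 2 / 8).card : ℝ) := by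
    exact_mod_cast hfreq
  -- momentum half: columns ≥ Y, points per column ≥ X
  have hcols := klac_card_cos_window_ge (L := L) hu huw hw
  have hcrit := klpw_card_criterion_ge (L := L) μ K hwin_lo hwin_hi
  have hlevel := kllc_levelSet_card_ge_of_criterion (L := L) μ K hAB
  have hshellN := klpw_card_shell_mono (L := L) μ K hB hB2 hA2
  have hshell : Y * X ≤ (((univ : Finset (TorusSite 2 L)).filter fun p => Λ ^ 2 / 2 ≤ nambuXiCT L μ K p ^ 2 ∧ nambuXiCT L μ K p ^ 2 ≤ 5 * Λ ^ 2 / 8).card : ℝ) := by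
    have h1 : Y * X ≤ (((univ : Finset (ZMod L)).filter fun a =>
        -2 * Real.cos (2 * π * (a.val : ℝ) / L) - 2 - μ + K.coeffNorm 0 < A ∧
          B < -2 * Real.cos (2 * π * (a.val : ℝ) / L) + 2 * Real.cos (π / L) - μ - K.coeffNorm 0).card : ℝ) * X :=
      mul_le_mul_of_nonneg_right (hcols.trans (by exact_mod_cast hcrit)) hX
    exact h1.trans (hlevel.trans (by exact_mod_cast hshellN))
  -- product
  have hprod := klpf_layer_card_ge (L := L) (M := M) μ K β Λ
  have hprodR : (((univ : Finset (MatsubaraIdx M)).filter fun ν => matsubaraFreq β M ν ^ 2 ≤ Λ ^ 2 / 8).card : ℝ) *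
      (((univ : Finset (TorusSite 2 L)).filter fun p => Λ ^ 2 / 2 ≤ nambuXiCT L μ K p ^ 2 ∧ nambuXiCT L μ K p ^ 2 ≤ 5 * Λ ^ 2 / 8).card : ℝ) ≤
      (((univ : Finset (FreqMomentum L M)).filter fun q =>
        Λ ^ 2 / 2 ≤ matsubaraFreq β M q.1 ^ 2 + nambuXiCT L μ K q.2 ^ 2 ∧ matsubaraFreq β M q.1 ^ 2 + nambuXiCT L μ K q.2 ^ 2 ≤ 3 * Λ ^ 2 / 4).card : ℝ) := by
    exact_mod_cast hprod
  by_cases hYX : 0 ≤ Y * X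
  · calc 2 * (k : ℝ) * (Y * X) ≤ (((univ : Finset (MatsubaraIdx M)).filter fun ν => matsubaraFreq β M ν ^ 2 ≤ Λ ^ 2 / 8).card : ℝ) *
          (((univ : Finset (TorusSite 2 L)).filter fun p => Λ ^ 2 / 2 ≤ nambuXiCT L μ K p ^ 2 ∧ nambuXiCT L μ K p ^ 2 ≤ 5 * Λ ^ 2 / 8).card : ℝ) :=
          mul_le_mul hfreqR hshell hYX (Nat.cast_nonneg _)
      _ ≤ _ := hprodR
  · push Not at hYX
    have h1 : 2 * (k : ℝ) * (Y * X) ≤ 0 := mul_nonpos_of_nonneg_of_nonpos (by positivity) hYX.le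
    exact h1.trans (Nat.cast_nonneg _)

/-! ## §3 The per-step pinned floor from explicit windows -/

/-- **(D3′) per-step pinned floor of the complementary members, from explicit windows** (`0 < β`, `n + 1 ≤ m`; the window hypotheses of `klpw_layer_card_ge`):
`(64/243)·(2k·Y·X)/(βL²Λ_n²) ≤ −Σ_p t_n[s_{n,m}](0,p)` — `b_lo` in closed form, uniform in `m`. [folklore] -/
theorem klpw_pinned_mass_floor_of_windows [NeZero M] (hβ : 0 < β) {n m : ℕ} (hnm : n + 1 ≤ m) {k : ℕ} (hk : k ≤ M) {W : ℝ}
    (hkW : (2 * (k : ℝ) - 1) * π / β ≤ W) (hW2 : W ^ 2 ≤ klScale klE0 n ^ 2 / 8) {A B : ℝ} (hAB : A ≤ B) (hB : B ≤ 0)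
    (hB2 : klScale klE0 n ^ 2 / 2 ≤ B ^ 2) (hA2 : A ^ 2 ≤ 5 * klScale klE0 n ^ 2 / 8) (hX : 0 ≤ (B - A) * L / (2 * π * (4 + K.coeffNorm 1)) - 1)
    {u w : ℝ} (hu : 0 ≤ u) (huw : u ≤ w) (hw : w ≤ π) (hwin_lo : (-2 - μ + K.coeffNorm 0 - A) / 2 ≤ Real.cos w)
    (hwin_hi : Real.cos u ≤ (2 * Real.cos (π / L) - μ - K.coeffNorm 0 - B) / 2) :
    64 / 243 * (2 * (k : ℝ) * ((((w - u) * L / (2 * π) - 1)) * ((B - A) * L / (2 * π * (4 + K.coeffNorm 1)) - 1)) /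
        (β * (L : ℝ) ^ 2 * klScale klE0 n ^ 2)) ≤
      -∑ p, klTransferWeight L M β μ K n (softSymbolCompl L M β μ K n m) 0 p := by
  have hΛ : 0 < klScale klE0 n := klth_klScale_pos n
  have hL : (1 : ℝ) ≤ L := by exact_mod_cast Nat.one_le_iff_ne_zero.2 (NeZero.ne L)
  have hden : 0 < β * (L : ℝ) ^ 2 * klScale klE0 n ^ 2 := by positivity
  have hlayer := klpw_layer_card_ge (L := L) (M := M) β μ K hβ n hk hkW hW2 hAB hB hB2 hA2 hX hu huw hw hwin_lo hwin_hi
  refine klpf_pinned_mass_floor (L := L) (M := M) β μ K hβ hnm (c₀ := 2 * (k : ℝ) *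
    ((((w - u) * L / (2 * π) - 1)) * ((B - A) * L / (2 * π * (4 + K.coeffNorm 1)) - 1)) / (β * (L : ℝ) ^ 2 * klScale klE0 n ^ 2)) ?_
  rw [div_mul_eq_mul_div, div_mul_eq_mul_div, div_le_iff₀ hden]
  calc 2 * (k : ℝ) * (((w - u) * L / (2 * π) - 1) * ((B - A) * L / (2 * π * (4 + K.coeffNorm 1)) - 1)) * (β * (L : ℝ) ^ 2) * klScale klE0 n ^ 2
      = 2 * (k : ℝ) * (((w - u) * L / (2 * π) - 1) * ((B - A) * L / (2 * π * (4 + K.coeffNorm 1)) - 1)) * (β * (L : ℝ) ^ 2 * klScale klE0 n ^ 2) := by ring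
    _ ≤ _ := mul_le_mul_of_nonneg_right hlayer hden.le

end Window

end Summit.HubbardSuperconductivity.HubbardSuperconductivity.Theorems.KLRegimeSplit

end
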